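import Summits.FinalStateConjecture.FinalStateConjecture.Theorems.EIHFluxBalanceLLSphericalChart
import Mathlib.MeasureTheory.Measure.Haar.InnerProductSpace
import Mathlib.MeasureTheory.Integral.Prod

/-!
# Route EIHFluxBalance — `LLBalanceLaw` (v): spherical coordinates on shells of `E3` and Fubini

Helper file for the support item `stmt-FinalStateConjecture-10189`
(`Summit.FinalStateConjecture.FinalStateConjecture.Theses.EIHFluxBalance.LLBalanceLaw`), clause (v).
The VOLUME half, complementing `EIHFluxBalanceLLSphericalChart`: the spherical change of
variables `Ψ(ρ, θ, φ) = ρ (sin θ cos φ, sin θ sin φ, cos θ)` on the box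
`(R, 2R) × (0, π) × (−π, π) ⊆ E3`, with

* derivative the `3 × 3` Jacobian (`hasFDerivAt_sphVol`) of determinant `ρ² sin θ`
  (`det_sphVolJacCLM`);
* injectivity on the box and image = the shell `{R < |y| < 2R}` minus the null half plane
  `{y₁ = 0}` (`injOn_sphVol`, `image_sphVol_ae_eq_shell`);
* Mathlib's change of variables (`integral_image_eq_integral_abs_det_fderiv_smul`):
  `∫_{R<|y|<2R} f = ∫_{box} ρ² sin θ · f(Ψ) d(ρ, θ, φ)` (`setIntegral_shell_eq_setIntegral_sphVolBox`);
* Fubini along the measure-preserving splitting `E3 ≃ᵐ ℝ × ℝ²`, `q ↦ (q 0, (q 1, q 2))`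
  (`setIntegral_sphVolBox_eq_iterated`), and, with the area formula on each sphere
  (`setIntegral_sphere_eq_setIntegral_sphBox`), the **centred shell formula**
  `∫_{R<|y|<2R} f = ∫_R^{2R} (∮_{|y|=ρ} f dμHE[2]) dρ` for `f` integrable on the shell
  (`setIntegral_shell_eq_integral_setIntegral_sphere`).

No definitions: the maps are explicit lambdas behind local notations (as in the chart file).
-/

noncomputable section

open MeasureTheory MeasureTheory.Measure Set Function Filter Metric Module Real
open scoped Topology ENNReal

namespace Summit.FinalStateConjecture.FinalStateConjecture.Theorems

namespace LLSphere

open Literature.Geometry.Lorentzian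

local notation "E2" => EuclideanSpace ℝ (Fin 2)

local notation "sphUnit" => (fun p : EuclideanSpace ℝ (Fin 2) ↦
  (WithLp.toLp 2 ![sin (p 0) * cos (p 1), sin (p 0) * sin (p 1), cos (p 0)] : E3))

local notation "sphBox" =>
  (setOf fun p : EuclideanSpace ℝ (Fin 2) ↦ p 0 ∈ Ioo 0 π ∧ p 1 ∈ Ioo (-π) π)

/-- The spherical change of variables `(ρ, θ, φ) = (q 0, q 1, q 2) ↦ ρ (sin θ cos φ, …)`. -/
local notation "sphVol" => (fun q : E3 ↦
  (WithLp.toLp 2 ![q 0 * (sin (q 1) * cos (q 2)), q 0 * (sin (q 1) * sin (q 2)),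
    q 0 * cos (q 1)] : E3))

/-- Its Jacobian matrix (rows = components, columns = `∂_ρ, ∂_θ, ∂_φ`). -/
local notation "sphVolJac" => (fun q : E3 ↦
  (!![sin (q 1) * cos (q 2), q 0 * (cos (q 1) * cos (q 2)), -(q 0 * (sin (q 1) * sin (q 2)));
      sin (q 1) * sin (q 2), q 0 * (cos (q 1) * sin (q 2)), q 0 * (sin (q 1) * cos (q 2));
      cos (q 1), -(q 0 * sin (q 1)), 0] : Matrix (Fin 3) (Fin 3) ℝ))

/-- The Jacobian as a continuous linear map of `E3`. -/
local notation "sphVolJacCLM" => (fun q : E3 ↦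
  LinearMap.toContinuousLinearMap (Matrix.toLpLin 2 2 (sphVolJac q) : E3 →ₗ[ℝ] E3))

/-! ### Derivative and Jacobian determinant -/

/-- Coordinates of the Jacobian applied to a vector. [folklore] -/
theorem sphVolJacCLM_apply (q v : E3) (i : Fin 3) :
    (sphVolJacCLM q v) i =
      (sphVolJac q) i 0 * v 0 + (sphVolJac q) i 1 * v 1 + (sphVolJac q) i 2 * v 2 := by
  fin_cases i <;> simp [Matrix.toLpLin_apply, dotProduct, Fin.sum_univ_three]

/-- The spherical map in the standard basis. [folklore] -/
theorem sphVol_eq_sum (q : E3) :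
    sphVol q = (q 0 * (sin (q 1) * cos (q 2))) • EuclideanSpace.single (0 : Fin 3) (1 : ℝ) +
      (q 0 * (sin (q 1) * sin (q 2))) • EuclideanSpace.single (1 : Fin 3) (1 : ℝ) +
        (q 0 * cos (q 1)) • EuclideanSpace.single (2 : Fin 3) (1 : ℝ) := by
  ext i
  fin_cases i <;> simp

/-- **The spherical change of variables is differentiable with derivative its Jacobian matrix.**
[folklore] -/
theorem hasFDerivAt_sphVol (q : E3) : HasFDerivAt sphVol (sphVolJacCLM q) q := by
  have h0 : HasFDerivAt (fun x : E3 ↦ (x 0 : ℝ))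
      (EuclideanSpace.proj (𝕜 := ℝ) (0 : Fin 3) : E3 →L[ℝ] ℝ) q :=
    (EuclideanSpace.proj (𝕜 := ℝ) (0 : Fin 3)).hasFDerivAt
  have h1 : HasFDerivAt (fun x : E3 ↦ (x 1 : ℝ))
      (EuclideanSpace.proj (𝕜 := ℝ) (1 : Fin 3) : E3 →L[ℝ] ℝ) q :=
    (EuclideanSpace.proj (𝕜 := ℝ) (1 : Fin 3)).hasFDerivAt
  have h2 : HasFDerivAt (fun x : E3 ↦ (x 2 : ℝ))
      (EuclideanSpace.proj (𝕜 := ℝ) (2 : Fin 3) : E3 →L[ℝ] ℝ) q :=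
    (EuclideanSpace.proj (𝕜 := ℝ) (2 : Fin 3)).hasFDerivAt
  have hs1 : HasFDerivAt (fun x : E3 ↦ sin (x 1))
      (cos (q 1) • (EuclideanSpace.proj (𝕜 := ℝ) (1 : Fin 3) : E3 →L[ℝ] ℝ)) q := by
    simpa [Function.comp_def] using (Real.hasDerivAt_sin (q 1)).comp_hasFDerivAt q h1
  have hc1 : HasFDerivAt (fun x : E3 ↦ cos (x 1))
      (-sin (q 1) • (EuclideanSpace.proj (𝕜 := ℝ) (1 : Fin 3) : E3 →L[ℝ] ℝ)) q := by
    simpa [Function.comp_def] using (Real.hasDerivAt_cos (q 1)).comp_hasFDerivAt q h1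
  have hs2 : HasFDerivAt (fun x : E3 ↦ sin (x 2))
      (cos (q 2) • (EuclideanSpace.proj (𝕜 := ℝ) (2 : Fin 3) : E3 →L[ℝ] ℝ)) q := by
    simpa [Function.comp_def] using (Real.hasDerivAt_sin (q 2)).comp_hasFDerivAt q h2
  have hc2 : HasFDerivAt (fun x : E3 ↦ cos (x 2))
      (-sin (q 2) • (EuclideanSpace.proj (𝕜 := ℝ) (2 : Fin 3) : E3 →L[ℝ] ℝ)) q := by
    simpa [Function.comp_def] using (Real.hasDerivAt_cos (q 2)).comp_hasFDerivAt q h2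
  have h := (((h0.mul (hs1.mul hc2)).smul_const (EuclideanSpace.single (0 : Fin 3) (1 : ℝ))).add
    ((h0.mul (hs1.mul hs2)).smul_const (EuclideanSpace.single (1 : Fin 3) (1 : ℝ)))).add
    ((h0.mul hc1).smul_const (EuclideanSpace.single (2 : Fin 3) (1 : ℝ)))
  have hfun : sphVol = fun q : E3 ↦
      (q 0 * (sin (q 1) * cos (q 2))) • EuclideanSpace.single (0 : Fin 3) (1 : ℝ) +
      (q 0 * (sin (q 1) * sin (q 2))) • EuclideanSpace.single (1 : Fin 3) (1 : ℝ) +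
        (q 0 * cos (q 1)) • EuclideanSpace.single (2 : Fin 3) (1 : ℝ) := funext sphVol_eq_sum
  rw [hfun]
  refine h.congr_fderiv ?_
  ext v i
  rw [sphVolJacCLM_apply]
  fin_cases i <;> simp <;> ring

/-- The Jacobian determinant of spherical coordinates is `ρ² sin θ`. [folklore] -/
theorem det_sphVolJac (q : E3) : (sphVolJac q).det = q 0 ^ 2 * sin (q 1) := by
  rw [Matrix.det_fin_three]
  simp only [Matrix.of_apply, Matrix.cons_val', Matrix.cons_val_zero, Matrix.cons_val_one,
    Matrix.cons_val_two, Matrix.cons_val_fin_one, Matrix.head_cons, Matrix.tail_cons,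
    Matrix.empty_val', Matrix.head_fin_const]
  linear_combination (q 0 ^ 2 * sin (q 1) * (sin (q 1) ^ 2 + cos (q 1) ^ 2)) *
    Real.sin_sq_add_cos_sq (q 2) + (q 0 ^ 2 * sin (q 1)) * Real.sin_sq_add_cos_sq (q 1)

/-- **The determinant of the derivative of spherical coordinates is `ρ² sin θ`.** [folklore] -/
theorem det_sphVolJacCLM (q : E3) : (sphVolJacCLM q).det = q 0 ^ 2 * sin (q 1) := by
  rw [ContinuousLinearMap.det, ← det_sphVolJac q]
  exact LinearMap.det_toLpLin 2 _

/-! ### Norm, injectivity and image -/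

/-- `‖Ψ(q)‖ = ρ` for `ρ = q 0 ≥ 0`. [folklore] -/
theorem norm_sphVol (q : E3) (hq : 0 ≤ q 0) : ‖sphVol q‖ = q 0 := by
  have h : sphVol q = q 0 • sphUnit (WithLp.toLp 2 ![q 1, q 2]) := by
    ext i
    fin_cases i <;> simp
  rw [h, norm_smul, norm_sphUnit, mul_one, Real.norm_of_nonneg hq]

/-- `Ψ(q) = ρ • sphUnit (θ, φ)`. [folklore] -/
theorem sphVol_eq_smul (q : E3) : sphVol q = q 0 • sphUnit (WithLp.toLp 2 ![q 1, q 2]) := by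
  ext i
  fin_cases i <;> simp

/-- **Spherical coordinates are injective on `(R, 2R) × (0, π) × (−π, π)`** (`R ≥ 0`): the radius is
the norm of the image, and the angles are recovered by `injOn_sphMap`. [folklore] -/
theorem injOn_sphVol {R : ℝ} (hR : 0 ≤ R) :
    InjOn sphVol {q : E3 | q 0 ∈ Ioo R (2 * R) ∧ q 1 ∈ Ioo 0 π ∧ q 2 ∈ Ioo (-π) π} := by
  intro q hq q' hq' h
  have hq0 : 0 < q 0 := hR.trans_lt hq.1.1
  have hq0' : 0 < q' 0 := hR.trans_lt hq'.1.1
  have hρ : q 0 = q' 0 := by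
    rw [← norm_sphVol q hq0.le, ← norm_sphVol q' hq0'.le]
    exact congrArg norm h
  rw [sphVol_eq_smul, sphVol_eq_smul, ← hρ] at h
  have hang := injOn_sphMap hq0.ne' (by simpa using hq.2) (by simpa using hq'.2) h
  have h1 : q 1 = q' 1 := by simpa using congrArg (fun p : E2 ↦ p 0) hang
  have h2 : q 2 = q' 2 := by simpa using congrArg (fun p : E2 ↦ p 1) hang
  ext i
  fin_cases i
  · exact hρ
  · exact h1
  · exact h2

/-- The image of the box lies in the shell `{R < |y| < 2R}`. [folklore] -/
theorem image_sphVol_subset_shell {R : ℝ} (hR : 0 ≤ R) :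
    sphVol '' {q : E3 | q 0 ∈ Ioo R (2 * R) ∧ q 1 ∈ Ioo 0 π ∧ q 2 ∈ Ioo (-π) π} ⊆
      {y : E3 | R < ‖y‖ ∧ ‖y‖ < 2 * R} := by
  rintro _ ⟨q, hq, rfl⟩
  have hq0 : 0 < q 0 := hR.trans_lt hq.1.1
  refine ⟨?_, ?_⟩ <;> simp only [norm_sphVol q hq0.le]
  exacts [hq.1.1, hq.1.2]

/-- **The shell minus the half plane `{y₁ = 0}` is covered**: the radius is `‖y‖`, the angles come
from `exists_sphMap_eq`. [folklore] -/
theorem shell_diff_image_sphVol_subset {R : ℝ} (hR : 0 ≤ R) :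
    {y : E3 | R < ‖y‖ ∧ ‖y‖ < 2 * R} \
        sphVol '' {q : E3 | q 0 ∈ Ioo R (2 * R) ∧ q 1 ∈ Ioo 0 π ∧ q 2 ∈ Ioo (-π) π} ⊆
      {y : E3 | y 1 = 0} := by
  rintro y ⟨hy, hni⟩
  by_contra h1
  have hpos : 0 < ‖y‖ := hR.trans_lt hy.1
  obtain ⟨p, hp, hpy⟩ := exists_sphMap_eq hpos (mem_sphere_zero_iff_norm.mpr rfl) h1
  refine hni ⟨WithLp.toLp 2 ![‖y‖, p 0, p 1], ⟨by simpa using hy, by simpa using hp.1,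
    by simpa using hp.2⟩, ?_⟩
  refine Eq.trans ?_ hpy
  ext i
  fin_cases i <;> simp

/-- The coordinate plane `{y₁ = 0}` is Lebesgue-null in `E3`. [folklore] -/
theorem volume_plane_eq_zero : volume {y : E3 | y 1 = 0} = 0 := by
  have h : {y : E3 | y 1 = 0} =
      (LinearMap.ker (EuclideanSpace.proj (𝕜 := ℝ) (1 : Fin 3) : E3 →ₗ[ℝ] ℝ) : Set E3) := by
    ext y
    simp
  rw [h]
  refine Measure.addHaar_submodule volume _ fun htop ↦ ?_
  have hmem : EuclideanSpace.single (1 : Fin 3) (1 : ℝ) ∈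
      LinearMap.ker (EuclideanSpace.proj (𝕜 := ℝ) (1 : Fin 3) : E3 →ₗ[ℝ] ℝ) := by
    rw [htop]
    exact Submodule.mem_top
  simp at hmem

/-- The image of the box is almost all of the shell. [folklore] -/
theorem image_sphVol_ae_eq_shell {R : ℝ} (hR : 0 ≤ R) :
    sphVol '' {q : E3 | q 0 ∈ Ioo R (2 * R) ∧ q 1 ∈ Ioo 0 π ∧ q 2 ∈ Ioo (-π) π} =ᵐ[volume]
      {y : E3 | R < ‖y‖ ∧ ‖y‖ < 2 * R} := by
  refine ae_eq_set.mpr ⟨?_, ?_⟩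
  · rw [Set.sdiff_eq_empty.mpr (image_sphVol_subset_shell hR), measure_empty]
  · exact measure_mono_null (shell_diff_image_sphVol_subset hR) volume_plane_eq_zero

/-- The box is open, hence measurable. [folklore] -/
theorem measurableSet_sphVolBox (R : ℝ) :
    MeasurableSet {q : E3 | q 0 ∈ Ioo R (2 * R) ∧ q 1 ∈ Ioo 0 π ∧ q 2 ∈ Ioo (-π) π} := by
  have h0 : Continuous fun q : E3 ↦ (q 0 : ℝ) := (EuclideanSpace.proj (𝕜 := ℝ) (0 : Fin 3)).continuous
  have h1 : Continuous fun q : E3 ↦ (q 1 : ℝ) := (EuclideanSpace.proj (𝕜 := ℝ) (1 : Fin 3)).continuous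
  have h2 : Continuous fun q : E3 ↦ (q 2 : ℝ) := (EuclideanSpace.proj (𝕜 := ℝ) (2 : Fin 3)).continuous
  exact ((isOpen_Ioo.preimage h0).inter ((isOpen_Ioo.preimage h1).inter
    (isOpen_Ioo.preimage h2))).measurableSet

/-! ### Change of variables on the shell -/

/-- **Spherical change of variables on a shell**: for `R ≥ 0` and any `f : E3 → ℝ`,
`∫_{R<|y|<2R} f = ∫_{(R,2R)×(0,π)×(−π,π)} ρ² sin θ · f(Ψ(ρ, θ, φ))`
(Mathlib's `integral_image_eq_integral_abs_det_fderiv_smul`; the uncovered half plane is null).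
[folklore] -/
theorem setIntegral_shell_eq_setIntegral_sphVolBox {R : ℝ} (hR : 0 ≤ R) (f : E3 → ℝ) :
    ∫ y in {y : E3 | R < ‖y‖ ∧ ‖y‖ < 2 * R}, f y =
      ∫ q in {q : E3 | q 0 ∈ Ioo R (2 * R) ∧ q 1 ∈ Ioo 0 π ∧ q 2 ∈ Ioo (-π) π},
        (q 0 ^ 2 * sin (q 1)) * f (sphVol q) := by
  rw [← setIntegral_congr_set (image_sphVol_ae_eq_shell hR),
    integral_image_eq_integral_abs_det_fderiv_smul volume (measurableSet_sphVolBox R)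
      (fun q _ ↦ (hasFDerivAt_sphVol q).hasFDerivWithinAt) (injOn_sphVol hR) f]
  refine setIntegral_congr_fun (measurableSet_sphVolBox R) fun q hq ↦ ?_
  simp only
  rw [det_sphVolJacCLM, smul_eq_mul, abs_of_pos]
  exact mul_pos (pow_pos (hR.trans_lt hq.1.1) 2) (sin_pos_of_mem_Ioo hq.2.1)

/-- **Integrability in the spherical change of variables**: if `f` is integrable on the shell
then `ρ² sin θ · f ∘ Ψ` is integrable on the box. [folklore] -/
theorem integrableOn_sphVolBox {R : ℝ} (hR : 0 ≤ R) {f : E3 → ℝ}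
    (hf : IntegrableOn f {y : E3 | R < ‖y‖ ∧ ‖y‖ < 2 * R}) :
    IntegrableOn (fun q : E3 ↦ (q 0 ^ 2 * sin (q 1)) * f (sphVol q))
      {q : E3 | q 0 ∈ Ioo R (2 * R) ∧ q 1 ∈ Ioo 0 π ∧ q 2 ∈ Ioo (-π) π} := by
  have hf' : IntegrableOn f
      (sphVol '' {q : E3 | q 0 ∈ Ioo R (2 * R) ∧ q 1 ∈ Ioo 0 π ∧ q 2 ∈ Ioo (-π) π}) :=
    hf.mono_set (image_sphVol_subset_shell hR)
  rw [integrableOn_image_iff_integrableOn_abs_det_fderiv_smul volume (measurableSet_sphVolBox R)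
      (fun q _ ↦ (hasFDerivAt_sphVol q).hasFDerivWithinAt) (injOn_sphVol hR)] at hf'
  refine (integrableOn_congr_fun (fun q hq ↦ ?_) (measurableSet_sphVolBox R)).mp hf'
  simp only
  rw [det_sphVolJacCLM, smul_eq_mul, abs_of_pos]
  exact mul_pos (pow_pos (hR.trans_lt hq.1.1) 2) (sin_pos_of_mem_Ioo hq.2.1)

/-! ### Fubini along `E3 ≃ ℝ × ℝ²` -/

/-- **Iterated integration over the box**: for `F` integrable on the box,
`∫_{box} F = ∫_R^{2R} ∫_{(0,π)×(−π,π)} F(ρ, θ, φ) d(θ, φ) dρ`, along the measure-preserving measurable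
equivalence `E3 ≃ᵐ ℝ × EuclideanSpace ℝ (Fin 2)`, `q ↦ (q 0, (q 1, q 2))`
(`volume_preserving_piFinSuccAbove` between the `WithLp` identifications) and Fubini on the
product set. [folklore] -/
theorem setIntegral_sphVolBox_eq_iterated {R : ℝ} (F : E3 → ℝ)
    (hF : IntegrableOn F {q : E3 | q 0 ∈ Ioo R (2 * R) ∧ q 1 ∈ Ioo 0 π ∧ q 2 ∈ Ioo (-π) π}) :
    ∫ q in {q : E3 | q 0 ∈ Ioo R (2 * R) ∧ q 1 ∈ Ioo 0 π ∧ q 2 ∈ Ioo (-π) π}, F q =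
      ∫ r in Ioo R (2 * R), ∫ p in sphBox, F (WithLp.toLp 2 ![r, p 0, p 1]) := by
  -- the splitting equivalence
  set e : E3 ≃ᵐ ℝ × E2 := ((MeasurableEquiv.toLp 2 (Fin 3 → ℝ)).symm.trans
    ((MeasurableEquiv.piFinSuccAbove (fun _ ↦ ℝ) 0).trans
      (MeasurableEquiv.prodCongr (MeasurableEquiv.refl ℝ)
        (MeasurableEquiv.toLp 2 (Fin 2 → ℝ))))) with he
  have hpres : MeasurePreserving e volume volume :=
    ((EuclideanSpace.volume_preserving_symm_measurableEquiv_toLp (Fin 3)).trans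
      ((volume_preserving_piFinSuccAbove (fun _ : Fin 3 ↦ ℝ) 0).trans
        ((MeasurePreserving.id volume).prod (PiLp.volume_preserving_toLp (Fin 2)))))
  have he1 : ∀ q : E3, (e q).1 = q 0 := fun q ↦ by
    simp [he, MeasurableEquiv.prodCongr]
  have he20 : ∀ q : E3, (e q).2 0 = q 1 := fun q ↦ by
    simp [he, MeasurableEquiv.prodCongr]
    rfl
  have he21 : ∀ q : E3, (e q).2 1 = q 2 := fun q ↦ by
    simp [he, MeasurableEquiv.prodCongr]
    rfl
  have hsymm : ∀ (r : ℝ) (p : E2), e.symm (r, p) = WithLp.toLp 2 ![r, p 0, p 1] := by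
    intro r p
    apply e.injective
    rw [MeasurableEquiv.apply_symm_apply]
    refine Prod.ext ?_ ?_
    · rw [he1]
      simp
    · ext i
      fin_cases i
      · simp only [Fin.zero_eta, Fin.isValue]
        rw [he20]
        simp
      · simp only [Fin.mk_one, Fin.isValue]
        rw [he21]
        simp
  have hpre : e ⁻¹' (Ioo R (2 * R) ×ˢ sphBox) =
      {q : E3 | q 0 ∈ Ioo R (2 * R) ∧ q 1 ∈ Ioo 0 π ∧ q 2 ∈ Ioo (-π) π} := by
    ext q
    simp only [mem_preimage, mem_prod, mem_setOf_eq, he1, he20, he21]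
  -- transport and Fubini
  have hF' : IntegrableOn (F ∘ e.symm) (Ioo R (2 * R) ×ˢ sphBox) (volume.prod volume) := by
    have h := (hpres.symm e).integrableOn_comp_preimage e.symm.measurableEmbedding
      (f := F) (s := {q : E3 | q 0 ∈ Ioo R (2 * R) ∧ q 1 ∈ Ioo 0 π ∧ q 2 ∈ Ioo (-π) π})
    rw [← hpre, MeasurableEquiv.symm_preimage_preimage] at h
    exact h.mpr hF
  calc ∫ q in {q : E3 | q 0 ∈ Ioo R (2 * R) ∧ q 1 ∈ Ioo 0 π ∧ q 2 ∈ Ioo (-π) π}, F q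
      = ∫ q in e ⁻¹' (Ioo R (2 * R) ×ˢ sphBox), (F ∘ e.symm) (e q) := by
        rw [hpre]
        refine setIntegral_congr_fun (measurableSet_sphVolBox R) fun q _ ↦ ?_
        simp
    _ = ∫ z in Ioo R (2 * R) ×ˢ sphBox, (F ∘ e.symm) z :=
        hpres.setIntegral_preimage_emb e.measurableEmbedding _ _
    _ = ∫ r in Ioo R (2 * R), ∫ p in sphBox, (F ∘ e.symm) (r, p) := setIntegral_prod _ hF'
    _ = ∫ r in Ioo R (2 * R), ∫ p in sphBox, F (WithLp.toLp 2 ![r, p 0, p 1]) := by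
        simp only [Function.comp_apply, hsymm]

/-- **The centred spherical shell formula**: for `R > 0` and `f` integrable on the shell,
`∫_{R<|y|<2R} f = ∫_R^{2R} (∮_{|y|=ρ} f dμHE[2]) dρ` (spherical coordinates on the shell, Fubini,
and the area formula on each sphere, `setIntegral_sphere_eq_setIntegral_sphBox`).
[cite: Federer1969, 3.2.5] -/
theorem setIntegral_shell_eq_integral_setIntegral_sphere {R : ℝ} (hR : 0 < R) {f : E3 → ℝ}
    (hf : IntegrableOn f {y : E3 | R < ‖y‖ ∧ ‖y‖ < 2 * R}) :
    ∫ y in {y : E3 | R < ‖y‖ ∧ ‖y‖ < 2 * R}, f y =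
      ∫ ρ in Ioo R (2 * R), ∫ y in sphere (0 : E3) ρ, f y ∂(μHE[2] : Measure E3) := by
  rw [setIntegral_shell_eq_setIntegral_sphVolBox hR.le,
    setIntegral_sphVolBox_eq_iterated _ (integrableOn_sphVolBox hR.le hf)]
  refine setIntegral_congr_fun measurableSet_Ioo fun ρ hρ ↦ ?_
  have hρ0 : 0 < ρ := hR.trans hρ.1
  rw [setIntegral_sphere_eq_setIntegral_sphBox hρ0 f]
  refine setIntegral_congr_fun measurableSet_sphBox fun p _ ↦ ?_
  have hq : (WithLp.toLp 2 ![ρ * (sin (p 0) * cos (p 1)), ρ * (sin (p 0) * sin (p 1)),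
      ρ * cos (p 0)] : E3) = ρ • sphUnit p := by
    ext i
    fin_cases i <;> simp
  simp only [Matrix.cons_val_zero, Matrix.cons_val_one, Matrix.cons_val_two, Matrix.head_cons,
    Matrix.tail_cons, hq]

end LLSphere

end Summit.FinalStateConjecture.FinalStateConjecture.Theorems

end
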